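import Literature.MathematicalPhysics.QuantumLattice.QuasiAdiabaticGenerator
import Mathlib
import HarnessLib

/-!
# `TcThermcert1` — QBP chain, PART 7b: Lieb–Robinson leakage of a restricted fermion dynamics

Helper theorems for stub B (`stub_farCutCurrent_of_clustering`) of the line `gauge_qbp_far_seam` on the crux
`TcThermcert1.ThermalStiffnessCeilingU8b8_le_7o44` (and its `β = 10` sibling).  PART 6
(`exists_qbp_conjugation_pair`) localises the quasi-adiabatic (QBP) conjugation of the seam perturbation `V` to a
collar of the seam, GIVEN a uniform bound `‖τ_t^{H + sV}(V) − τ_t^{H_r + sV}(V)‖ ≤ ε` for `|t| ≤ T`, `s ∈ [0, 1]`,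
where `H_r` keeps only the local terms inside the collar.  This file proves the model-free half of that bound for an
ARBITRARY finite family `k Z` of even local terms indexed by the bonds and sites of a graph (`HubbardIdx G`) — which
covers the restricted Hubbard terms with the `s`-dependent complex (Peierls) seam hoppings merged into the seam bonds,
uniformly in `s` because only `sup_Z ‖k Z‖ ≤ J` enters:

* §1 `norm_heisenbergEvolution_add_sub_le_of_commutator` — Duhamel / interaction picture:
  `‖τ^{K+W}_t(V) − τ^K_t(V)‖ ≤ |t| · sup_{|u| ≤ |t|} ‖[W, τ^K_u(V)]‖`;
* §2 `fermion_lieb_robinson_localTerms` — the fermionic Lieb–Robinson bound of `FermionLiebRobinson`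
  (`lieb_robinson_abstract` + graded locality) for such a family, and its two-sided-in-time form `…_abs`;
* §3 `norm_commutator_sum_le_of_locality` — only the terms of `W` whose support meets the collar contribute;
* §4 `norm_heisenbergEvolution_sub_restricted_le` — the composed leakage estimate: full minus restricted dynamics of a
  collar-supported `V` is bounded by `|t|` times the boundary terms, each carrying `‖[V, k Z]‖` plus a Lieb–Robinson tail
  `e^{2eJD|t| − dist}`.

What remains for the stub (PART 7c, torus geometry + arithmetic): instantiate §4 on `fermionTorusGraph 2 L` with the
collar `|x₁| ≤ r`, `δ_Z =` graph distance to `supp Z`, count the boundary terms (`O(L)`), and choose `r ≍ L/4`, `T ≍ L`.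
Sources: Hastings–Koma, CMP 265 (2006) App. A; Nachtergaele–Sims, CMP 265 (2006) Thm. 1; Bratteli–Robinson II §5.2.2,
§6.2.1; Capel–Moscolari–Teufel–Wessel, arXiv:2310.09182, Prop. 6 / Thm. 14 (where this leakage bound is the input
`(ii)` of the localisation of the QBP generator).  SC in the Hubbard model is NOT proved by anything here.
-/

noncomputable section

open Matrix Finset
open Literature.MathematicalPhysics.QuantumLattice

namespace Summit.Ventures.CertifiedManyBodySolver.Theorems.TcThermcert1.GaugeQbpFarSeam

open scoped Matrix.Norms.L2Operator

/-! ### §1 Duhamel: perturbing the generator -/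

section Duhamel

variable {m : Type*} [Fintype m] [DecidableEq m]

/-- `τ^{−H}_t = τ^H_{−t}`. Bratteli–Robinson II §6.2.1. [folklore] -/
theorem heisenbergEvolution_neg_generator (H : Matrix m m ℂ) (t : ℝ) (A : Matrix m m ℂ) :
    heisenbergEvolution (-H) t A = heisenbergEvolution H (-t) A := by
  simp only [heisenbergEvolution, smul_neg, ← neg_smul, Complex.ofReal_neg, mul_neg, neg_neg]

/-- `τ_u(−W) = −τ_u(W)`. [folklore] -/
theorem heisenbergEvolution_neg_obs (H : Matrix m m ℂ) (u : ℝ) (W : Matrix m m ℂ) :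
    heisenbergEvolution H u (-W) = -heisenbergEvolution H u W := by
  simp only [heisenbergEvolution, Matrix.mul_neg, Matrix.neg_mul]

/-- **Duhamel leakage bound.** If `‖[W, τ^K_u(V)]‖ ≤ η` for all `|u| ≤ |t|` (the perturbation `W` of the generator
almost commutes with the `K`-evolved observable), then `‖τ^{K+W}_t(V) − τ^K_t(V)‖ ≤ η |t|`: the interaction-picture
formula `norm_heisenbergEvolution_sub_heisenbergEvolution_le_of_le` with the commutator transported by the isometry
`τ^K_u` (`norm_commutator_heisenbergEvolution_neg`). Bratteli–Robinson II, Prop. 5.4.1 / §6.2.1; Hastings–Koma 2006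
App. A. [cite: HastingsKoma2006, App. A] -/
theorem norm_heisenbergEvolution_add_sub_le_of_commutator {K W V : Matrix m m ℂ} (hK : K.IsHermitian)
    (hW : W.IsHermitian) {t η : ℝ}
    (h : ∀ u : ℝ, |u| ≤ |t| → ‖W * heisenbergEvolution K u V - heisenbergEvolution K u V * W‖ ≤ η) :
    ‖heisenbergEvolution (K + W) t V - heisenbergEvolution K t V‖ ≤ η * |t| := by
  rw [norm_sub_rev]
  refine norm_heisenbergEvolution_sub_heisenbergEvolution_le_of_le hK (hK.add hW) V fun u hu => ?_
  rw [sub_add_cancel_left, heisenbergEvolution_neg_obs, neg_mul, mul_neg, neg_sub_neg, norm_sub_rev,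
    ← norm_commutator_heisenbergEvolution_neg hK u W V]
  exact h (-u) (by rwa [abs_neg])

end Duhamel

/-! ### §2 The fermionic Lieb–Robinson bound for a general family of even local terms -/

section LocalTerms

variable {Λ : Type*} [LinearOrder Λ] [Fintype Λ] (G : SimpleGraph Λ) [DecidableRel G.Adj]

/-- **Lieb–Robinson bound for an arbitrary even finite-range lattice-fermion interaction on a graph.** Let `k Z`,
`Z ∈ HubbardIdx G` (ordered bonds and sites of `G`, maximal degree `≤ Δ`), be Hermitian, even and supported on
`supp Z` (`k Z ∈ 𝔄⁺(supp Z)`), with `‖k Z‖ ≤ J` — e.g. the Hubbard terms restricted to a region, with complex Peierls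
phases on some bonds.  For `A ∈ 𝔄(X)`, `B ∈ 𝔄(Y)` and any `δ : Λ → ℕ` vanishing on `Y` and `1`-Lipschitz along edges,
for `s ≥ 0`: `‖[τ_s(A), B]‖ ≤ ‖[A, B]‖ + 2‖A‖ Σ_{Z : supp Z ∩ X ≠ ∅} 2J‖B‖ s e^{2eJ·2(2Δ+1) s − min_{supp Z} δ}` — the
template `fermion_lieb_robinson_hamiltonianWith` of the tree with `hubbardTermOp` replaced by `k` (abstract bound
`lieb_robinson_abstract`, graded locality `commute_of_mem_carEvenSubalgebra`). Hastings–Koma, CMP 265 (2006) 781,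
App. A; Nachtergaele–Sims, CMP 265 (2006) 119, Thm. 1; Bratteli–Robinson II §5.2.2. [cite: HastingsKoma2006, App. A] -/
theorem fermion_lieb_robinson_localTerms {Δ : ℕ}
    (hΔ : ∀ x : Λ, (Finset.univ.filter fun y => G.Adj x y).card ≤ Δ)
    (k : HubbardIdx G → Matrix (Finset (Orb Λ)) (Finset (Orb Λ)) ℂ) (hk : ∀ Z, (k Z).IsHermitian)
    (hkloc : ∀ Z, k Z ∈ carEvenSubalgebra (orbSet (hubbardTermSupp G Z)))
    {J : ℝ} (hJ0 : 0 ≤ J) (hJ : ∀ Z, ‖k Z‖ ≤ J)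
    {X Y : Finset Λ} {A B : Matrix (Finset (Orb Λ)) (Finset (Orb Λ)) ℂ}
    (hA : A ∈ carSubalgebra (orbSet X)) (hB : B ∈ carSubalgebra (orbSet Y))
    (δ : Λ → ℕ) (hδY : ∀ y ∈ Y, δ y = 0) (hδ : ∀ x y, G.Adj x y → δ x ≤ δ y + 1)
    {s : ℝ} (hs : 0 ≤ s) :
    ‖heisenbergEvolution (∑ Z, k Z) s A * B - B * heisenbergEvolution (∑ Z, k Z) s A‖ ≤
      ‖A * B - B * A‖ + 2 * ‖A‖ *
        ∑ Z ∈ Finset.univ.filter (fun Z : HubbardIdx G => ¬ Disjoint (hubbardTermSupp G Z) X),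
          2 * J * ‖B‖ * s * Real.exp (Real.exp 1 * (2 * J * (2 * (2 * Δ + 1) : ℕ)) * s -
              ((hubbardTermSupp G Z).inf' (hubbardTermSupp_nonempty G Z) δ : ℕ)) := by
  classical
  have hcomm : ∀ (Z : HubbardIdx G) {S : Finset Λ} {M : Matrix (Finset (Orb Λ)) (Finset (Orb Λ)) ℂ},
      M ∈ carSubalgebra (orbSet S) → Disjoint (hubbardTermSupp G Z) S → Commute (k Z) M :=
    fun Z S M hM hd => commute_of_mem_carEvenSubalgebra (hkloc Z) hM (disjoint_orbSet hd)
  refine lieb_robinson_abstract k hk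
    (fun Z' Z => ¬ Disjoint (hubbardTermSupp G Z') (hubbardTermSupp G Z)) ?_
    hJ0 hJ ?_ B (fun Z => (hubbardTermSupp G Z).inf' (hubbardTermSupp_nonempty G Z) δ) ?_ ?_ A _ ?_ hs
  · -- non-touching terms commute (graded locality; the terms are even)
    intro Z Z' hZZ'
    rw [not_not] at hZZ'
    exact hcomm Z' ((carEvenSubalgebra_le_carSubalgebra _) (hkloc Z)) hZZ'
  · -- at most `2(2Δ+1)` terms touch a given term
    intro Z
    refine (card_filter_not_disjoint_hubbardTermSupp_le G hΔ _).trans ?_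
    have hcard : (hubbardTermSupp G Z).card ≤ 2 := by
      cases Z with
      | inl p => exact Finset.card_insert_le _ _ |>.trans (by simp)
      | inr x => simp [hubbardTermSupp]
    calc (hubbardTermSupp G Z).card * (2 * Δ + 1) ≤ 2 * (2 * Δ + 1) := Nat.mul_le_mul_right _ hcard
      _ = (2 * (2 * Δ + 1) : ℕ) := rfl
  · -- terms at positive level do not meet `Y`, hence commute with `B`
    intro Z hZ
    refine hcomm Z hB (Finset.disjoint_left.2 fun z hzZ hzY => hZ ?_)
    exact Nat.eq_zero_of_le_zero ((Finset.inf'_le δ hzZ).trans (hδY z hzY).le)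
  · -- the level drops by at most one along touching terms
    intro Z Z' hZZ'
    obtain ⟨w, hwZ', hwZ⟩ := Finset.not_disjoint_iff.1 hZZ'
    obtain ⟨z', hz', hmin⟩ := Finset.exists_mem_eq_inf' (hubbardTermSupp_nonempty G Z') δ
    rw [hmin]
    refine (Finset.inf'_le δ hwZ).trans ?_
    rcases eq_or_adj_of_mem_hubbardTermSupp G hwZ' hz' with h | h
    · rw [h]; exact Nat.le_succ _
    · exact hδ w z' h
  · -- terms not meeting `X` commute with `A`
    intro Z hZ
    rw [Finset.mem_filter, not_and, not_not] at hZ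
    exact hcomm Z hA (hZ (Finset.mem_univ _))

/-- **Two-sided-in-time form** of `fermion_lieb_robinson_localTerms` (`|s|` in place of `s ≥ 0`): for `s < 0` apply the
bound to the family `−k` (`τ^{Σ k}_s = τ^{Σ (−k)}_{−s}`). [cite: HastingsKoma2006, App. A] -/
theorem fermion_lieb_robinson_localTerms_abs {Δ : ℕ}
    (hΔ : ∀ x : Λ, (Finset.univ.filter fun y => G.Adj x y).card ≤ Δ)
    (k : HubbardIdx G → Matrix (Finset (Orb Λ)) (Finset (Orb Λ)) ℂ) (hk : ∀ Z, (k Z).IsHermitian)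
    (hkloc : ∀ Z, k Z ∈ carEvenSubalgebra (orbSet (hubbardTermSupp G Z)))
    {J : ℝ} (hJ0 : 0 ≤ J) (hJ : ∀ Z, ‖k Z‖ ≤ J)
    {X Y : Finset Λ} {A B : Matrix (Finset (Orb Λ)) (Finset (Orb Λ)) ℂ}
    (hA : A ∈ carSubalgebra (orbSet X)) (hB : B ∈ carSubalgebra (orbSet Y))
    (δ : Λ → ℕ) (hδY : ∀ y ∈ Y, δ y = 0) (hδ : ∀ x y, G.Adj x y → δ x ≤ δ y + 1) (s : ℝ) :
    ‖heisenbergEvolution (∑ Z, k Z) s A * B - B * heisenbergEvolution (∑ Z, k Z) s A‖ ≤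
      ‖A * B - B * A‖ + 2 * ‖A‖ *
        ∑ Z ∈ Finset.univ.filter (fun Z : HubbardIdx G => ¬ Disjoint (hubbardTermSupp G Z) X),
          2 * J * ‖B‖ * |s| * Real.exp (Real.exp 1 * (2 * J * (2 * (2 * Δ + 1) : ℕ)) * |s| -
              ((hubbardTermSupp G Z).inf' (hubbardTermSupp_nonempty G Z) δ : ℕ)) := by
  rcases le_or_gt 0 s with hs | hs
  · rw [abs_of_nonneg hs]
    exact fermion_lieb_robinson_localTerms G hΔ k hk hkloc hJ0 hJ hA hB δ hδY hδ hs
  · have hneg : heisenbergEvolution (∑ Z, k Z) s A = heisenbergEvolution (∑ Z, -k Z) (-s) A := by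
      rw [Finset.sum_neg_distrib, heisenbergEvolution_neg_generator, neg_neg]
    rw [hneg, abs_of_neg hs]
    exact fermion_lieb_robinson_localTerms G hΔ (fun Z => -k Z) (fun Z => (hk Z).neg)
      (fun Z => neg_mem (hkloc Z)) hJ0 (fun Z => (norm_neg (k Z)).le.trans (hJ Z)) hA hB δ hδY hδ
      (neg_nonneg.2 hs.le)

/-! ### §3 Graded locality: only boundary terms see the collar -/

omit [DecidableRel G.Adj] in
/-- **Only the terms meeting `X` fail to commute with `𝔄(X)`**: for `O ∈ 𝔄(X)` and even local terms `k Z ∈ 𝔄⁺(supp Z)`,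
`‖[Σ_{Z ∈ T} k Z, O]‖ ≤ Σ_{Z ∈ T, supp Z ∩ X ≠ ∅} ‖[k Z, O]‖` (the other commutators vanish by graded commutativity).
Bratteli–Robinson II §5.2.2. [cite: BratteliRobinsonII1997, §5.2.2] -/
theorem norm_commutator_sum_le_of_locality
    (k : HubbardIdx G → Matrix (Finset (Orb Λ)) (Finset (Orb Λ)) ℂ)
    (hkloc : ∀ Z, k Z ∈ carEvenSubalgebra (orbSet (hubbardTermSupp G Z)))
    (T : Finset (HubbardIdx G)) {X : Finset Λ} {O : Matrix (Finset (Orb Λ)) (Finset (Orb Λ)) ℂ}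
    (hO : O ∈ carSubalgebra (orbSet X)) :
    ‖(∑ Z ∈ T, k Z) * O - O * ∑ Z ∈ T, k Z‖ ≤
      ∑ Z ∈ T.filter (fun Z => ¬ Disjoint (hubbardTermSupp G Z) X), ‖k Z * O - O * k Z‖ := by
  classical
  rw [finset_sum_commutator,
    ← Finset.sum_filter_add_sum_filter_not T (fun Z => ¬ Disjoint (hubbardTermSupp G Z) X)]
  refine (norm_add_le _ _).trans ?_
  rw [Finset.sum_eq_zero (s := T.filter fun Z => ¬¬ Disjoint (hubbardTermSupp G Z) X) ?_, norm_zero, add_zero]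
  · exact norm_sum_le _ _
  · intro Z hZ
    rw [Finset.mem_filter, not_not] at hZ
    rw [(commute_of_mem_carEvenSubalgebra (hkloc Z) hO (disjoint_orbSet hZ.2)).eq, sub_self]

/-! ### §4 The leakage of a collar-restricted dynamics -/

/-- **Leakage bound: full versus collar-restricted dynamics of a collar-supported observable.**  Let `k Z` be
Hermitian even local terms with `‖k Z‖ ≤ J` on a graph of degree `≤ Δ`, `T` a set of terms supported in a region `X`
(the collar), and `V ∈ 𝔄⁺(X_V)` with `X_V ⊆ X`.  Then for every `t`,
`‖τ^{Σ_Z k Z}_t(V) − τ^{Σ_{Z ∈ T} k Z}_t(V)‖ ≤ (Σ_{Z ∉ T, supp Z ∩ X ≠ ∅} (‖[V, k Z]‖ + 2‖V‖ Σ_{Z' : supp Z' ∩ X_V ≠ ∅}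
2J‖k Z‖|t| e^{2eJ·2(2Δ+1)|t| − min_{supp Z'} δ_Z})) · |t|` for any levels `δ_Z : Λ → ℕ` vanishing on `supp Z` and
`1`-Lipschitz along edges (e.g. the graph distance to `supp Z`): §1 with `W = Σ_{Z ∉ T} k Z`, §3 for the restricted
evolution `τ^{Σ_T k}_u(V) ∈ 𝔄⁺(X)` (`heisenbergEvolution_mem_subalgebra`), and §2 for the restricted family
`Z ↦ (Z ∈ T ? k Z : 0)`.  With `X_V` = the seam, `X` = a collar of width `r`, `|t| ≤ T ≍ r`, the exponent is `≍ −r`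
off the light cone: this is input `(ii)` of the localisation of the quasi-adiabatic generator, Capel–Moscolari–
Teufel–Wessel, arXiv:2310.09182, proof of Thm. 14 / Prop. 6; Hastings–Koma 2006 App. A. [cite: CapelEtAl2023, Thm. 14] -/
theorem norm_heisenbergEvolution_sub_restricted_le {Δ : ℕ}
    (hΔ : ∀ x : Λ, (Finset.univ.filter fun y => G.Adj x y).card ≤ Δ)
    (k : HubbardIdx G → Matrix (Finset (Orb Λ)) (Finset (Orb Λ)) ℂ) (hk : ∀ Z, (k Z).IsHermitian)
    (hkloc : ∀ Z, k Z ∈ carEvenSubalgebra (orbSet (hubbardTermSupp G Z)))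
    {J : ℝ} (hJ0 : 0 ≤ J) (hJ : ∀ Z, ‖k Z‖ ≤ J)
    (T : Finset (HubbardIdx G)) {X : Finset Λ} (hT : ∀ Z ∈ T, hubbardTermSupp G Z ⊆ X)
    {XV : Finset Λ} (hXV : XV ⊆ X) {V : Matrix (Finset (Orb Λ)) (Finset (Orb Λ)) ℂ}
    (hV : V ∈ carEvenSubalgebra (orbSet XV))
    (δ : HubbardIdx G → Λ → ℕ) (hδ0 : ∀ Z, ∀ y ∈ hubbardTermSupp G Z, δ Z y = 0)
    (hδ1 : ∀ Z x y, G.Adj x y → δ Z x ≤ δ Z y + 1) (t : ℝ) :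
    ‖heisenbergEvolution (∑ Z, k Z) t V - heisenbergEvolution (∑ Z ∈ T, k Z) t V‖ ≤
      (∑ Z ∈ Tᶜ.filter (fun Z => ¬ Disjoint (hubbardTermSupp G Z) X),
        (‖V * k Z - k Z * V‖ + 2 * ‖V‖ *
          ∑ Z' ∈ Finset.univ.filter (fun Z' : HubbardIdx G => ¬ Disjoint (hubbardTermSupp G Z') XV),
            2 * J * ‖k Z‖ * |t| * Real.exp (Real.exp 1 * (2 * J * (2 * (2 * Δ + 1) : ℕ)) * |t| -
              ((hubbardTermSupp G Z').inf' (hubbardTermSupp_nonempty G Z') (δ Z) : ℕ)))) * |t| := by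
  classical
  -- the restricted family, as a family over all of `HubbardIdx G`
  set kT : HubbardIdx G → Matrix (Finset (Orb Λ)) (Finset (Orb Λ)) ℂ := fun Z => if Z ∈ T then k Z else 0
    with hkT
  have hsumT : ∑ Z, kT Z = ∑ Z ∈ T, k Z := by
    rw [hkT]
    simp only
    rw [Finset.sum_ite_mem, Finset.univ_inter]
  have hkTh : ∀ Z, (kT Z).IsHermitian := fun Z => by
    simp only [hkT]
    split_ifs
    · exact hk Z
    · exact isHermitian_zero
  have hkTloc : ∀ Z, kT Z ∈ carEvenSubalgebra (orbSet (hubbardTermSupp G Z)) := fun Z => by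
    simp only [hkT]
    split_ifs
    · exact hkloc Z
    · exact zero_mem _
  have hkTn : ∀ Z, ‖kT Z‖ ≤ J := fun Z => by
    simp only [hkT]
    split_ifs
    · exact hJ Z
    · rw [norm_zero]; exact hJ0
  have hKh : (∑ Z ∈ T, k Z).IsHermitian := isHermitian_finset_sum _ fun Z _ => hk Z
  have hWh : (∑ Z ∈ Tᶜ, k Z).IsHermitian := isHermitian_finset_sum _ fun Z _ => hk Z
  have hsplit : ∑ Z, k Z = ∑ Z ∈ T, k Z + ∑ Z ∈ Tᶜ, k Z := (Finset.sum_add_sum_compl T k).symm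
  -- the restricted dynamics keeps `V` inside the collar algebra
  have hKmem : ∑ Z ∈ T, k Z ∈ carEvenSubalgebra (orbSet X) :=
    Subalgebra.sum_mem _ fun Z hZ =>
      carEvenSubalgebra_mono (fun o ho => mem_orbSet.2 (hT Z hZ (mem_orbSet.1 ho))) (hkloc Z)
  have hVX : V ∈ carEvenSubalgebra (orbSet X) :=
    carEvenSubalgebra_mono (fun o ho => mem_orbSet.2 (hXV (mem_orbSet.1 ho))) hV
  have hOmem : ∀ u : ℝ, heisenbergEvolution (∑ Z ∈ T, k Z) u V ∈ carSubalgebra (orbSet X) := fun u =>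
    carEvenSubalgebra_le_carSubalgebra _ (heisenbergEvolution_mem_subalgebra _ hKmem hVX u)
  have hB : ∀ Z, k Z ∈ carSubalgebra (orbSet (hubbardTermSupp G Z)) := fun Z =>
    carEvenSubalgebra_le_carSubalgebra _ (hkloc Z)
  have hc0 : 0 ≤ Real.exp 1 * (2 * J * (2 * (2 * Δ + 1) : ℕ)) := by positivity
  rw [hsplit]
  refine norm_heisenbergEvolution_add_sub_le_of_commutator hKh hWh fun u hu => ?_
  refine (norm_commutator_sum_le_of_locality G k hkloc Tᶜ (hOmem u)).trans (Finset.sum_le_sum fun Z _ => ?_)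
  rw [norm_sub_rev, ← hsumT]
  refine (fermion_lieb_robinson_localTerms_abs G hΔ kT hkTh hkTloc hJ0 hkTn
    (carEvenSubalgebra_le_carSubalgebra _ hV) (hB Z) (δ Z) (hδ0 Z) (hδ1 Z) u).trans ?_
  refine add_le_add le_rfl (mul_le_mul_of_nonneg_left (Finset.sum_le_sum fun Z' _ => ?_) (by positivity))
  have h1 : 2 * J * ‖k Z‖ * |u| ≤ 2 * J * ‖k Z‖ * |t| := mul_le_mul_of_nonneg_left hu (by positivity)
  have h2 : Real.exp (Real.exp 1 * (2 * J * (2 * (2 * Δ + 1) : ℕ)) * |u| -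
        ((hubbardTermSupp G Z').inf' (hubbardTermSupp_nonempty G Z') (δ Z) : ℕ)) ≤
      Real.exp (Real.exp 1 * (2 * J * (2 * (2 * Δ + 1) : ℕ)) * |t| -
        ((hubbardTermSupp G Z').inf' (hubbardTermSupp_nonempty G Z') (δ Z) : ℕ)) :=
    Real.exp_le_exp.2 (sub_le_sub_right (mul_le_mul_of_nonneg_left hu hc0) _)
  exact mul_le_mul h1 h2 (Real.exp_pos _).le (by positivity)

end LocalTerms

end Summit.Ventures.CertifiedManyBodySolver.Theorems.TcThermcert1.GaugeQbpFarSeam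

end
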